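import Summits.ResolutionOfSingularities.ResolutionOfSingularities.Theorems.HilbertSamuelEliminationSigmaMaxModificationsCorridor3SigmaBoundaryRuns
import HarnessLib

/-!
# [OURS · L1 W4.2] σ-LAYER — `Corridor3SigmaOracleCJS`: THE FALLBACK ORACLE OF RECORD `ω := StageOracleE.cjs R` (the CJS oracle `R` LIFTED to a
# boundary-reading stage oracle), its functionality, its «centres over the non-regular locus» clause (`hωsing` of the Low suppliers), its
# permissibility clause, and the identification `ofStageOracleE (cjs R)`-steps = CJS canonical steps

Crux chain w42 (`SigmaMaxModifications`, stmt-ResolutionOfSingularities-18506; conjunct `SigmaMaxModificationsCorridor3`,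
stmt-ResolutionOfSingularities-19249), res-L1-w42-plan-1 g12 RULING v3.14-35 (HR) «(D-ii) YES — ω OF RECORD := the LIFTED CJS-CANONICAL ORACLE … please
also supply the CONSTRUCTOR (`ωCJS` / `exists_stageOracleE_cjs` with `OracleFunctionalΩE` + the names-over-singular-locus fact) so the (π₀, ω, E₀)
assembler instantiates it». Typer res-type-040 (gen 19). ONE definition (the constructor, a composite of res-type-040's `StageOracle.lift` p520734 and
res-D-pv-047's `StageOracle.withBoundary` p523856) + `Iff.rfl`-grade facts. OURS (cell res-hironaka, slot W4.2); NOT statements of H. Hironaka's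
manuscript [Hironaka2017] nor of [CossartJannsenSaito2020]; AI-typed, weaker than expert review. Helper vocabulary
`--supports stmt-ResolutionOfSingularities-19249 --as helper` (counted 0).

Contents (namespace `…Theorems.SigmaMaxModificationsCorridor3.Sigma`): `StageOracleE.cjs R`, `StageOracleE.cjs_namesE_iff` (`Iff.rfl`),
`StageOracleE.cjs_eq_lift_withBoundary` (`rfl`), `oracleFunctionalΩE_cjs` (⟸ `OracleFunctional R`), **`centresOver_compl_regularLocus_of_cjs_namesE`** (= the
hypothesis `hωsing` of `…WLadderHybridLowReplay`, ⟸ `OracleAdmissible R`), `allPermissible_of_cjs_namesE` / `isRegular_top_of_cjs_namesE` (clause (a) inputs of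
the fallback, ⟸ `OracleAdmissible R`), `ofStageOracleE_cjs_step_iff` (the fallback's step relation IS `IsCanonicalStep R`, boundary ignored) and
`ofStageOracleE_cjs_step_iff_cjs_withBoundary`. In the CORE stub's proof the `R` is the stub's own binder `∀ R, OracleFunctional R → OracleAdmissible R → …`,
so no existence statement is needed: `ω := StageOracleE.cjs R`. References: CJS LNM 2270 Rem. 6.29 (1), Def. 3.1 [CossartJannsenSaito2020]; tree
`…SigmaCycleDefs` (p520734), `…SigmaBoundaryRuns` (p523856), `…CampaignW42Tertiary` (`OracleFunctional`, `OracleAdmissible`, `IsCanonicalStep`).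
-/

noncomputable section

set_option linter.dupNamespace false

open CategoryTheory AlgebraicGeometry TopologicalSpace
open Summit.ResolutionOfSingularities.ResolutionOfSingularities.Theorems.CampaignW42
open Literature.AlgebraicGeometry.Resolution Literature.RingTheory.HilbertSamuel

namespace Summit.ResolutionOfSingularities.ResolutionOfSingularities.Theorems.SigmaMaxModificationsCorridor3.Sigma

universe u

variable {R : ∀ S : Scheme.{u}, CentreSeq S → Prop}

/-- [OURS · L1 W4.2] **THE FALLBACK ORACLE OF RECORD `ω_CJS(R)`**: the CJS oracle `R` (sequences named on the ABSTRACT part `S`) read as a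
boundary-reading stage oracle — it ignores the stage, the labels and the boundary (`= (StageOracle.lift R).withBoundary`). With it the fallback
`StrategyE.ofStageOracleE (StageOracleE.cjs R)` of the menu hybrid steps exactly by CJS's canonical steps `IsCanonicalStep R`. NOT a statement of the
manuscript. [cite: CossartJannsenSaito2020, Rem. 6.29 (1)] -/
def StageOracleE.cjs (R : ∀ S : Scheme.{u}, CentreSeq S → Prop) : StageOracleE.{u} :=
  (StageOracle.lift R).withBoundary

/-- Unfolding (`Iff.rfl`). [folklore] -/
@[simp] theorem StageOracleE.cjs_namesE_iff (R : ∀ S : Scheme.{u}, CentreSeq S → Prop) (W : Scheme.{u}) (hW : IsLocallyNoetherian W)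
    (N : ℕ) (ν : ℕ → ℕ) (L : Labelling W) (E : Boundary W) (S : Scheme.{u}) (φ : S ⟶ W) (t : CentreSeq S) :
    (StageOracleE.cjs R).namesE W hW N ν L E S φ t ↔ R S t :=
  Iff.rfl

/-- The constructor is the composite of the two lifts (`rfl`). [folklore] -/
theorem StageOracleE.cjs_eq_lift_withBoundary (R : ∀ S : Scheme.{u}, CentreSeq S → Prop) :
    StageOracleE.cjs R = (StageOracle.lift R).withBoundary :=
  rfl

/-- **`ω_CJS(R)` is functional for a functional `R`.** [folklore] -/
theorem oracleFunctionalΩE_cjs (hRf : OracleFunctional R) : OracleFunctionalΩE (StageOracleE.cjs R) :=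
  oracleFunctionalΩE_withBoundary (oracleFunctionalΩ_lift hRf)

/-- **THE `hωsing` CLAUSE: `ω_CJS(R)` names sequences whose centres lie over the NON-REGULAR locus of the part** (second clause of
`OracleAdmissible R`). This is the hypothesis `hωsing` of `strataReplaySettleFromσE_hybrid_of_cycleStartRegular` (`…WLadderHybridLowReplay`).
[cite: CossartJannsenSaito2020, Rem. 6.29 (1)] -/
theorem centresOver_compl_regularLocus_of_cjs_namesE (hRa : OracleAdmissible R) :
    ∀ (W : Scheme.{u}) (hW : IsLocallyNoetherian W) (N : ℕ) (ν : ℕ → ℕ) (L : Labelling W) (E : Boundary W) (S : Scheme.{u})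
      (φ : S ⟶ W) (t : CentreSeq S), (StageOracleE.cjs R).namesE W hW N ν L E S φ t → t.CentresOver (Scheme.regularLocus S)ᶜ :=
  fun _ _ _ _ _ _ S _ t ht => (hRa S t ht).2.1

/-- `ω_CJS(R)` names sequences of PERMISSIBLE centres (first clause of `OracleAdmissible R`). [cite: CossartJannsenSaito2020, Def. 3.1, Rem. 6.29 (1)] -/
theorem allPermissible_of_cjs_namesE (hRa : OracleAdmissible R) {W : Scheme.{u}} {hW : IsLocallyNoetherian W} {N : ℕ} {ν : ℕ → ℕ}
    {L : Labelling W} {E : Boundary W} {S : Scheme.{u}} {φ : S ⟶ W} {t : CentreSeq S}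
    (ht : (StageOracleE.cjs R).namesE W hW N ν L E S φ t) : t.AllPermissible :=
  (hRa S t ht).1

/-- `ω_CJS(R)` names sequences with a REGULAR last stage (third clause of `OracleAdmissible R`). [cite: CossartJannsenSaito2020, Rem. 6.29 (1)] -/
theorem isRegular_top_of_cjs_namesE (hRa : OracleAdmissible R) {W : Scheme.{u}} {hW : IsLocallyNoetherian W} {N : ℕ} {ν : ℕ → ℕ}
    {L : Labelling W} {E : Boundary W} {S : Scheme.{u}} {φ : S ⟶ W} {t : CentreSeq S}
    (ht : (StageOracleE.cjs R).namesE W hW N ν L E S φ t) : Literature.AlgebraicGeometry.Resolution.Scheme.IsRegular t.top :=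
  (hRa S t ht).2.2

/-- **THE FALLBACK WITH `ω_CJS(R)` STEPS BY CJS's CANONICAL STEPS** (the boundary is carried, never read). [cite: CossartJannsenSaito2020, Rem. 6.29 (1)] -/
theorem ofStageOracleE_cjs_step_iff (R : ∀ S : Scheme.{u}, CentreSeq S → Prop) (W : Scheme.{u}) (hW : IsLocallyNoetherian W) (N : ℕ)
    (ν : ℕ → ℕ) (L : Labelling W) (P : Option (Pending W)) (E : Boundary W) (C : W.IdealSheafData) (P' : Option (Pending (blowup C))) :
    (StrategyE.ofStageOracleE (StageOracleE.cjs R)).step W hW N ν L P E C P' ↔ IsCanonicalStep R N ν L P C P' := by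
  rw [StageOracleE.cjs_eq_lift_withBoundary, StrategyE.ofStageOracleE_step_iff, isCanonicalStepΩE_withBoundary_iff, isCanonicalStepΩ_lift_iff]

/-- … equivalently, by the step relation of `(Strategy.cjs R).withBoundary`. [folklore] -/
theorem ofStageOracleE_cjs_step_iff_cjs_withBoundary (R : ∀ S : Scheme.{u}, CentreSeq S → Prop) (W : Scheme.{u})
    (hW : IsLocallyNoetherian W) (N : ℕ) (ν : ℕ → ℕ) (L : Labelling W) (P : Option (Pending W)) (E : Boundary W) (C : W.IdealSheafData)
    (P' : Option (Pending (blowup C))) :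
    (StrategyE.ofStageOracleE (StageOracleE.cjs R)).step W hW N ν L P E C P' ↔ (Strategy.cjs R).withBoundary.step W hW N ν L P E C P' := by
  rw [ofStageOracleE_cjs_step_iff]
  exact Iff.rfl

end Summit.ResolutionOfSingularities.ResolutionOfSingularities.Theorems.SigmaMaxModificationsCorridor3.Sigma

end
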